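import Literature.Computability.AlgebraicComplexity.STPPGlobalShift
import Literature.Computability.AlgebraicComplexity.STPPMapHom
import Literature.Computability.AlgebraicComplexity.STPPLineFamilies
import HarnessLib

/-!
# (2,2,2)^k STPP families in (ℤ/p)³ — part A: three explicit families of automorphisms of `ℤ/p × ℤ/p × ℤ/p`

Cell `pub-omega` (unit `pub-omega-eng1-g29`, ENG1), topic `Summits/MatrixMultiplication/OmegaCensus`.
Framing (verbatim): lottery ticket; floor = certified bounds/negative ranges. HONEST FRAMING: explicit shears and coordinate swaps — the `GL₃(𝔽_p)` facts behind
the 'gl' normal form of ENG1's SAT encoder `enc2.py` for the census cell P-041 (used by `STPP222GLNormalForm.lean`): `GL₃` is transitive on nonzero vectors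
(`exists_map_eq_e1`), the stabiliser of `e₁` fixes the line `⟨e₁⟩` pointwise and is transitive off it (`exists_fix_e1_map_eq_e2`, `apply_eq_self_of_inLine`), the
stabiliser of `(e₁, e₂)` fixes the plane pointwise and is transitive off it (`exists_fix_e1_e2_map_eq_e3`, `apply_eq_self_of_inPlane`); `e₁ = (0,0,1)`, `e₂ = (0,1,0)`,
`e₃ = (1,0,0)` (element codes 1, p, p²). Nothing here decides P-041 and nothing is a bound on `ω`.
-/

namespace Summit.MatrixMultiplication.OmegaCensus

open Finset Literature.Computability.AlgebraicComplexity

namespace GLNF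

variable {p : ℕ} [Fact p.Prime]

/-- The ambient group `V = ℤ/p × ℤ/p × ℤ/p` (as in the kernel witness files). -/
abbrev V (p : ℕ) := ZMod p × ZMod p × ZMod p

/-- `e₁ = (0,0,1)` (element code 1). -/
def e1 : V p := (0, 0, 1)
/-- `e₂ = (0,1,0)` (element code p). -/
def e2 : V p := (0, 1, 0)
/-- `e₃ = (1,0,0)` (element code p²). -/
def e3 : V p := (1, 0, 0)

/-- `x` lies on the line `⟨e₁⟩`. -/
def InLine (x : V p) : Prop := x.1 = 0 ∧ x.2.1 = 0
/-- `x` lies in the plane `⟨e₁, e₂⟩`. -/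
def InPlane (x : V p) : Prop := x.1 = 0

/-- The element code used by the encoders (mixed radix, last coordinate least significant). -/
def code (x : V p) : ℕ := x.1.val * p ^ 2 + x.2.1.val * p + x.2.2.val

/-! ### Three explicit families of automorphisms of `V` -/

/-- Shear sending `a` with `a.2.2 ≠ 0` to `e₁`. -/
def shearE1 (a : V p) (ha : a.2.2 ≠ 0) : V p ≃+ V p where
  toFun x := (x.1 - a.1 * a.2.2⁻¹ * x.2.2, x.2.1 - a.2.1 * a.2.2⁻¹ * x.2.2, a.2.2⁻¹ * x.2.2)
  invFun y := (y.1 + a.1 * y.2.2, y.2.1 + a.2.1 * y.2.2, a.2.2 * y.2.2)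
  left_inv x := by
    ext
    · show x.1 - a.1 * a.2.2⁻¹ * x.2.2 + a.1 * (a.2.2⁻¹ * x.2.2) = x.1; ring
    · show x.2.1 - a.2.1 * a.2.2⁻¹ * x.2.2 + a.2.1 * (a.2.2⁻¹ * x.2.2) = x.2.1; ring
    · show a.2.2 * (a.2.2⁻¹ * x.2.2) = x.2.2; rw [← mul_assoc, mul_inv_cancel₀ ha, one_mul]
  right_inv y := by
    ext
    · show y.1 + a.1 * y.2.2 - a.1 * a.2.2⁻¹ * (a.2.2 * y.2.2) = y.1
      rw [mul_assoc a.1 a.2.2⁻¹, ← mul_assoc a.2.2⁻¹, inv_mul_cancel₀ ha, one_mul]; ring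
    · show y.2.1 + a.2.1 * y.2.2 - a.2.1 * a.2.2⁻¹ * (a.2.2 * y.2.2) = y.2.1
      rw [mul_assoc a.2.1 a.2.2⁻¹, ← mul_assoc a.2.2⁻¹, inv_mul_cancel₀ ha, one_mul]; ring
    · show a.2.2⁻¹ * (a.2.2 * y.2.2) = y.2.2; rw [← mul_assoc, inv_mul_cancel₀ ha, one_mul]
  map_add' x y := by ext <;> simp only [Prod.fst_add, Prod.snd_add] <;> ring

/-- `shearE1 a` sends `a` to `e₁`. -/
theorem shearE1_apply_self (a : V p) (ha : a.2.2 ≠ 0) : shearE1 a ha a = e1 := by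
  ext
  · show a.1 - a.1 * a.2.2⁻¹ * a.2.2 = 0; rw [mul_assoc, inv_mul_cancel₀ ha, mul_one, sub_self]
  · show a.2.1 - a.2.1 * a.2.2⁻¹ * a.2.2 = 0; rw [mul_assoc, inv_mul_cancel₀ ha, mul_one, sub_self]
  · show a.2.2⁻¹ * a.2.2 = 1; exact inv_mul_cancel₀ ha

/-- Shear fixing `e₁` and sending `b` with `b.2.1 ≠ 0` to `e₂`. -/
def shearE2 (b : V p) (hb : b.2.1 ≠ 0) : V p ≃+ V p where
  toFun x := (x.1 - b.1 * b.2.1⁻¹ * x.2.1, b.2.1⁻¹ * x.2.1, x.2.2 - b.2.2 * b.2.1⁻¹ * x.2.1)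
  invFun y := (y.1 + b.1 * y.2.1, b.2.1 * y.2.1, y.2.2 + b.2.2 * y.2.1)
  left_inv x := by
    ext
    · show x.1 - b.1 * b.2.1⁻¹ * x.2.1 + b.1 * (b.2.1⁻¹ * x.2.1) = x.1; ring
    · show b.2.1 * (b.2.1⁻¹ * x.2.1) = x.2.1; rw [← mul_assoc, mul_inv_cancel₀ hb, one_mul]
    · show x.2.2 - b.2.2 * b.2.1⁻¹ * x.2.1 + b.2.2 * (b.2.1⁻¹ * x.2.1) = x.2.2; ring
  right_inv y := by
    ext
    · show y.1 + b.1 * y.2.1 - b.1 * b.2.1⁻¹ * (b.2.1 * y.2.1) = y.1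
      rw [mul_assoc b.1 b.2.1⁻¹, ← mul_assoc b.2.1⁻¹, inv_mul_cancel₀ hb, one_mul]; ring
    · show b.2.1⁻¹ * (b.2.1 * y.2.1) = y.2.1; rw [← mul_assoc, inv_mul_cancel₀ hb, one_mul]
    · show y.2.2 + b.2.2 * y.2.1 - b.2.2 * b.2.1⁻¹ * (b.2.1 * y.2.1) = y.2.2
      rw [mul_assoc b.2.2 b.2.1⁻¹, ← mul_assoc b.2.1⁻¹, inv_mul_cancel₀ hb, one_mul]; ring
  map_add' x y := by ext <;> simp only [Prod.fst_add, Prod.snd_add] <;> ring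

/-- `shearE2 b` fixes `e₁`. -/
theorem shearE2_apply_e1 (b : V p) (hb : b.2.1 ≠ 0) : shearE2 b hb e1 = e1 := by
  ext
  · show (0 : ZMod p) - b.1 * b.2.1⁻¹ * 0 = 0; ring
  · show b.2.1⁻¹ * (0 : ZMod p) = 0; ring
  · show (1 : ZMod p) - b.2.2 * b.2.1⁻¹ * 0 = 1; ring

/-- `shearE2 b` sends `b` to `e₂`. -/
theorem shearE2_apply_self (b : V p) (hb : b.2.1 ≠ 0) : shearE2 b hb b = e2 := by
  ext
  · show b.1 - b.1 * b.2.1⁻¹ * b.2.1 = 0; rw [mul_assoc, inv_mul_cancel₀ hb, mul_one, sub_self]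
  · show b.2.1⁻¹ * b.2.1 = 1; exact inv_mul_cancel₀ hb
  · show b.2.2 - b.2.2 * b.2.1⁻¹ * b.2.1 = 0; rw [mul_assoc, inv_mul_cancel₀ hb, mul_one, sub_self]

/-- Shear fixing `e₁, e₂` and sending `c` with `c.1 ≠ 0` to `e₃`. -/
def shearE3 (c : V p) (hc : c.1 ≠ 0) : V p ≃+ V p where
  toFun x := (c.1⁻¹ * x.1, x.2.1 - c.2.1 * c.1⁻¹ * x.1, x.2.2 - c.2.2 * c.1⁻¹ * x.1)
  invFun y := (c.1 * y.1, y.2.1 + c.2.1 * y.1, y.2.2 + c.2.2 * y.1)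
  left_inv x := by
    ext
    · show c.1 * (c.1⁻¹ * x.1) = x.1; rw [← mul_assoc, mul_inv_cancel₀ hc, one_mul]
    · show x.2.1 - c.2.1 * c.1⁻¹ * x.1 + c.2.1 * (c.1⁻¹ * x.1) = x.2.1; ring
    · show x.2.2 - c.2.2 * c.1⁻¹ * x.1 + c.2.2 * (c.1⁻¹ * x.1) = x.2.2; ring
  right_inv y := by
    ext
    · show c.1⁻¹ * (c.1 * y.1) = y.1; rw [← mul_assoc, inv_mul_cancel₀ hc, one_mul]
    · show y.2.1 + c.2.1 * y.1 - c.2.1 * c.1⁻¹ * (c.1 * y.1) = y.2.1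
      rw [mul_assoc c.2.1 c.1⁻¹, ← mul_assoc c.1⁻¹, inv_mul_cancel₀ hc, one_mul]; ring
    · show y.2.2 + c.2.2 * y.1 - c.2.2 * c.1⁻¹ * (c.1 * y.1) = y.2.2
      rw [mul_assoc c.2.2 c.1⁻¹, ← mul_assoc c.1⁻¹, inv_mul_cancel₀ hc, one_mul]; ring
  map_add' x y := by ext <;> simp only [Prod.fst_add, Prod.snd_add] <;> ring

/-- `shearE3 c` fixes `e₁`. -/
theorem shearE3_apply_e1 (c : V p) (hc : c.1 ≠ 0) : shearE3 c hc e1 = e1 := by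
  ext
  · show c.1⁻¹ * (0 : ZMod p) = 0; ring
  · show (0 : ZMod p) - c.2.1 * c.1⁻¹ * 0 = 0; ring
  · show (1 : ZMod p) - c.2.2 * c.1⁻¹ * 0 = 1; ring

/-- `shearE3 c` fixes `e₂`. -/
theorem shearE3_apply_e2 (c : V p) (hc : c.1 ≠ 0) : shearE3 c hc e2 = e2 := by
  ext
  · show c.1⁻¹ * (0 : ZMod p) = 0; ring
  · show (1 : ZMod p) - c.2.1 * c.1⁻¹ * 0 = 1; ring
  · show (0 : ZMod p) - c.2.2 * c.1⁻¹ * 0 = 0; ring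

/-- `shearE3 c` sends `c` to `e₃`. -/
theorem shearE3_apply_self (c : V p) (hc : c.1 ≠ 0) : shearE3 c hc c = e3 := by
  ext
  · show c.1⁻¹ * c.1 = 1; exact inv_mul_cancel₀ hc
  · show c.2.1 - c.2.1 * c.1⁻¹ * c.1 = 0; rw [mul_assoc, inv_mul_cancel₀ hc, mul_one, sub_self]
  · show c.2.2 - c.2.2 * c.1⁻¹ * c.1 = 0; rw [mul_assoc, inv_mul_cancel₀ hc, mul_one, sub_self]

/-- Coordinate swap `(x₀,x₁,x₂) ↦ (x₀,x₂,x₁)`. -/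
def swap12 : V p ≃+ V p where
  toFun x := (x.1, x.2.2, x.2.1)
  invFun x := (x.1, x.2.2, x.2.1)
  left_inv _ := rfl
  right_inv _ := rfl
  map_add' _ _ := rfl

/-- Coordinate swap `(x₀,x₁,x₂) ↦ (x₂,x₁,x₀)`. -/
def swap02 : V p ≃+ V p where
  toFun x := (x.2.2, x.2.1, x.1)
  invFun x := (x.2.2, x.2.1, x.1)
  left_inv _ := rfl
  right_inv _ := rfl
  map_add' _ _ := rfl

/-- Coordinate swap `(x₀,x₁,x₂) ↦ (x₁,x₀,x₂)` (fixes `e₁`). -/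
def swap01 : V p ≃+ V p where
  toFun x := (x.2.1, x.1, x.2.2)
  invFun x := (x.2.1, x.1, x.2.2)
  left_inv _ := rfl
  right_inv _ := rfl
  map_add' _ _ := rfl

/-- **`GL₃(𝔽_p)` is transitive on nonzero vectors** (explicit): every `a ≠ 0` is mapped to `e₁` by an automorphism. -/
theorem exists_map_eq_e1 (a : V p) (ha : a ≠ 0) : ∃ φ : V p ≃+ V p, φ a = e1 := by
  by_cases h2 : a.2.2 ≠ 0
  · exact ⟨shearE1 a h2, shearE1_apply_self a h2⟩
  by_cases h1 : a.2.1 ≠ 0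
  · refine ⟨swap12.trans (shearE1 (swap12 a) h1), ?_⟩
    show shearE1 (swap12 a) h1 (swap12 a) = e1
    exact shearE1_apply_self _ _
  have h0 : a.1 ≠ 0 := by
    intro h0; apply ha
    push Not at h1 h2
    ext <;> simp [h0, h1, h2]
  refine ⟨swap02.trans (shearE1 (swap02 a) h0), ?_⟩
  show shearE1 (swap02 a) h0 (swap02 a) = e1
  exact shearE1_apply_self _ _

/-- **The stabiliser of `e₁` is transitive off the line `⟨e₁⟩`:** every `b ∉ ⟨e₁⟩` is mapped to `e₂` by an automorphism fixing `e₁`. -/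
theorem exists_fix_e1_map_eq_e2 (b : V p) (hb : ¬ InLine b) : ∃ φ : V p ≃+ V p, φ e1 = e1 ∧ φ b = e2 := by
  by_cases h1 : b.2.1 ≠ 0
  · exact ⟨shearE2 b h1, shearE2_apply_e1 b h1, shearE2_apply_self b h1⟩
  have h0 : b.1 ≠ 0 := by
    intro h0; push Not at h1; exact hb ⟨h0, h1⟩
  refine ⟨swap01.trans (shearE2 (swap01 b) h0), ?_, ?_⟩
  · show shearE2 (swap01 b) h0 (swap01 e1) = e1
    have : (swap01 (e1 : V p)) = e1 := rfl
    rw [this]; exact shearE2_apply_e1 _ _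
  · show shearE2 (swap01 b) h0 (swap01 b) = e2
    exact shearE2_apply_self _ _

/-- **The stabiliser of `(e₁, e₂)` is transitive off the plane `⟨e₁, e₂⟩`.** -/
theorem exists_fix_e1_e2_map_eq_e3 (c : V p) (hc : ¬ InPlane c) :
    ∃ φ : V p ≃+ V p, φ e1 = e1 ∧ φ e2 = e2 ∧ φ c = e3 :=
  ⟨shearE3 c hc, shearE3_apply_e1 c hc, shearE3_apply_e2 c hc, shearE3_apply_self c hc⟩

/-- An element of the line is the `val`-multiple of `e₁`. -/
theorem eq_nsmul_e1_of_inLine {x : V p} (hx : InLine x) : x = x.2.2.val • (e1 : V p) := by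
  obtain ⟨h0, h1⟩ := hx
  ext
  · simp [e1, h0]
  · simp [e1, h1]
  · simp [e1]

/-- An element of the plane is a combination of `e₁, e₂` with `val`-coefficients. -/
theorem eq_nsmul_add_of_inPlane {x : V p} (hx : InPlane x) : x = x.2.2.val • (e1 : V p) + x.2.1.val • (e2 : V p) := by
  have h0 : x.1 = 0 := hx
  ext
  · simp [e1, e2, h0]
  · simp [e1, e2]
  · simp [e1, e2]

/-- An automorphism fixing `e₁` fixes the line pointwise. -/
theorem apply_eq_self_of_inLine (φ : V p ≃+ V p) (h1 : φ e1 = e1) {x : V p} (hx : InLine x) : φ x = x := by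
  rw [eq_nsmul_e1_of_inLine hx, map_nsmul, h1]

/-- An automorphism fixing `e₁, e₂` fixes the plane pointwise. -/
theorem apply_eq_self_of_inPlane (φ : V p ≃+ V p) (h1 : φ e1 = e1) (h2 : φ e2 = e2) {x : V p} (hx : InPlane x) : φ x = x := by
  rw [eq_nsmul_add_of_inPlane hx, map_add, map_nsmul, map_nsmul, h1, h2]

end GLNF

end Summit.MatrixMultiplication.OmegaCensus
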